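import Literature.AlgebraicGeometry.Resolution.PointBlowupKangaroo
import Mathlib.Algebra.CharP.Lemmas
import HarnessLib

/-!
# Moh's bound `+p^{e−1}` is attained for every prime `p` and every exponent `e`, already for surfaces

Topic: `Literature/AlgebraicGeometry/Resolution`. Companion (cell `pub-hironaka`, unit
`b2b-hironaka-cp4`, DIM-4 CENSUS gen 14) of `PointBlowupMohBoundPrimePower.lean`
(`PointBlowup.mohBound`: after one point blow-up of the purely inseparable hypersurface
`x^{pᵉ} + F(y) = 0`, read at any point of the exceptional divisor and cleaned, the shade rises by
at most `p^{e−1}` — [Moh1987] p. 966, [HauserPerlega2019PRIMS] §3 Theorem (9), [Hauser2010] §F) and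
of `PointBlowupMohBound.lean`, whose only sharpness witness is Hauser's kangaroo point
(`p = 2`, `e = 1`, `Hauser2003_kangarooShadeIncrease`). Here: **for EVERY prime `p` and EVERY
`e ≥ 1` the bound is attained**, by the MONOMIAL residual polynomial in two variables

  `F = y₀^{p^{e−1}(p−1)} · y₁^{p^{e−1}(p+1)}`,  exceptional multiplicities `r = (p^{e−1}(p−1), p^{e−1}(p+1))`

(so `yʳ = F`: residual order / shade `0`, the "monomial case"), of order `2pᵉ`, at the point
`y₁ = 1` of the `y₀`-chart of the blow-up of the origin: the translated chart transform is
`y₀^{q}(y₁ + 1)^{q + p^{e−1}} = y₀^{q}(y₁^{q + p^{e−1}} + y₁^{q} + y₁^{p^{e−1}} + 1)` (`q = pᵉ`; two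
applications of `(u + v)^{pᵏ} = u^{pᵏ} + v^{pᵏ}`), the cleaning `x ↦ x + y₀y₁ + y₀` deletes the two
`q`-th powers, and the new state `(y₀^{q} y₁^{p^{e−1}}(1 + y₁^{q}), r′ = (q, 0))` has shade
`p^{e−1}`: an increase by exactly `p^{e−1}` at an equiconstant point (kangaroo point), in every
characteristic, for every `e`, in dimension two. Written with `e + 1` for `e` below (no
subtraction): `q = p^{e+1}`, jump `pᵉ`.

Printed context: the increase under one blow-up "is bounded by `p^{e−1}`" [Moh1987, p. 966],
[HauserPerlega2019, §3], [HauserPerlega2024, p. 777 and §7 p. 798 ("still valid in higher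
dimensions")]; the printed attained instances known to the cell are Hauser's kangaroo (`p = 2`,
`e = 1`) and Hauser–Perlega's `z⁴ + x²y²w³(w(x+y)⁴ + x¹³)` (`p = 2`, `e = 2`, `d = 5 ↦ 7`,
[HauserPerlega2019, §3]; tree `hauserPerlega_mohProofBoundFails`). The one-monomial family is
the cell's (found by the gen-14 search engine `code/b2b-hironaka-cp4-g14/mohseq_q.py`, then proved
here for all `p`, `e`); it is consistent with Hauser–Perlega's characterisation ([HauserPerlega2019PRIMS]
§3 Theorem: (2) `o = w·c!` with `w = 2`; (6) with `T` = both components, `ℓ = e − 1`, `b = 2`: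
`r̄₀ + r̄₁ = p^{e−1}(p−1) + p^{e−1} = pᵉ ≤ (2−1)·pᵉ`, the boundary case; Comment (d): two components
lost). Nothing here is a statement about resolution of singularities; census value only (row O5 of
the dimension-4 census of `pub-hironaka`: the kernel one-step bound at multiplicity `pᵉ` is optimal
for every `p` and `e`). [folklore]
-/

noncomputable section

open MvPolynomial Finset

open scoped BigOperators

namespace Literature.AlgebraicGeometry.Resolution

open Literature.AlgebraicGeometry.Resolution.Hauser2010
open Literature.Barriers.ResolutionOfSingularities

namespace PointBlowup

section Attained

variable (p : ℕ) [hp : Fact p.Prime] (K : Type*) [Field K] [CharP K p] [DecidableEq K]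

omit [DecidableEq K] in
/-- The order of a monomial with a unit coefficient is its degree. [folklore] -/
theorem ordZero_monomial_one {σ : Type*} (d : σ →₀ ℕ) :
    ordZero (monomial d (1 : K)) = d.degree := by
  classical
  rw [ordZero_eq_nat_iff]
  refine ⟨⟨d, by simp, rfl⟩, fun d' hd' => ?_⟩
  rw [coeff_monomial, if_neg]
  rintro rfl
  exact absurd hd' (lt_irrefl _)

/-- The chart transform of a single monomial. [folklore] -/
theorem chartTransform_monomial_one {σ : Type*} [DecidableEq σ] (q : ℕ) (j : σ) (d : σ →₀ ℕ) :
    chartTransform q j (monomial d (1 : K)) = monomial (chartExponent q j d) 1 := by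
  unfold chartTransform
  rw [support_monomial, if_neg one_ne_zero, Finset.sum_singleton, coeff_monomial, if_pos rfl]

/-- In characteristic `p`: `(u + 1)^{pᵉ(p+1)} = u^{p^{e+1} + pᵉ} + u^{p^{e+1}} + u^{pᵉ} + 1` in
any commutative ring — two applications of the freshman's dream. [folklore] -/
theorem add_one_pow_prime_pow_mul_succ {R : Type*} [CommRing R] [CharP R p] (u : R) (e : ℕ) :
    (u + 1) ^ (p ^ e * (p + 1)) =
      u ^ (p ^ (e + 1) + p ^ e) + u ^ p ^ (e + 1) + u ^ p ^ e + 1 := by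
  have h1 : (u + 1) ^ p ^ e = u ^ p ^ e + 1 := by
    have := add_pow_char_pow u 1 p e
    rwa [one_pow] at this
  have h2 : (u ^ p ^ e + 1) ^ p = u ^ p ^ (e + 1) + 1 := by
    have := add_pow_char (u ^ p ^ e) 1 p
    rw [one_pow, ← pow_mul, ← pow_succ] at this
    exact this
  calc (u + 1) ^ (p ^ e * (p + 1))
      = ((u + 1) ^ p ^ e) ^ (p + 1) := by rw [pow_mul]
    _ = (u ^ p ^ e + 1) ^ p * (u ^ p ^ e + 1) := by rw [h1, pow_succ]
    _ = (u ^ p ^ (e + 1) + 1) * (u ^ p ^ e + 1) := by rw [h2]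
    _ = u ^ (p ^ (e + 1) + p ^ e) + u ^ p ^ (e + 1) + u ^ p ^ e + 1 := by ring

/-- **Moh's bound is attained, every `p`, every exponent, two residual variables** (working form,
with the exponents as named naturals: `q = p^{e+1}`, `a = pᵉ(p−1)`, `m = pᵉ(p+1)`). For the state
`s = (y₀ᵃ y₁ᵐ, (a, m))` (shade `0`) and a point `b = (0, 1)` of the `y₀`-chart: `F` is cleaned,
divisible by `yʳ`, of order `2q ≥ q`; the point is equiconstant; the new state has residual
polynomial `y₀^{q}y₁^{q+pᵉ} + y₀^{q}y₁^{pᵉ}`, multiplicities `(q, 0)` and shade EXACTLY `pᵉ` — the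
bound of `PointBlowup.mohBound` (`MohBound p (e+1)`) holds with equality, and the point is a
kangaroo point. (Compare [HauserPerlega2019PRIMS] §3 Theorem (2), (6) — boundary case
`Σ r̄ᵢ = (b−1)p^{ℓ+1}` with `b = 2`, `ℓ = e` — and Comment (d).) [folklore] -/
theorem mohBound_attained_of_eq (e : ℕ) {q a m : ℕ} (hq : q = p ^ (e + 1))
    (ha : a = p ^ e * (p - 1)) (hm : m = p ^ e * (p + 1)) (b : Fin 2 → K) (hb0 : b 0 = 0)
    (hb1 : b 1 = 1) :
    let s : State (Fin 2) K :=
      ⟨monomial (Finsupp.single 0 a + Finsupp.single 1 m) 1, Finsupp.single 0 a + Finsupp.single 1 m⟩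
    deletePthPowers q s.F = s.F ∧ (∀ d ∈ s.F.support, s.r ≤ d) ∧
      ordZero s.F = ((2 * q : ℕ) : ℕ∞) ∧ s.shade = 0 ∧ IsEquimultiplePoint q 0 b s ∧
      (step q 0 b s).F =
        monomial (Finsupp.single 0 q + Finsupp.single 1 (q + p ^ e)) 1 +
          monomial (Finsupp.single 0 q + Finsupp.single 1 (p ^ e)) 1 ∧
      (step q 0 b s).r = Finsupp.single 0 q ∧
      (step q 0 b s).shade = ((p ^ e : ℕ) : ℕ∞) ∧ ShadeIncreases q 0 b s ∧ IsKangarooPoint q 0 b s := by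
  intro s
  have hp1 : 1 < p := hp.out.one_lt
  have hqe : q = p ^ e * p := by rw [hq, pow_succ]
  have hpe : 0 < p ^ e := pow_pos hp.out.pos _
  have hqpos : 0 < q := by rw [hq]; exact pow_pos hp.out.pos _
  have hsum : a + m = 2 * q := by
    rw [ha, hm, hqe, ← mul_add]
    have : p - 1 + (p + 1) = 2 * p := by omega
    rw [this]; ring
  set d₀ : Fin 2 →₀ ℕ := Finsupp.single 0 a + Finsupp.single 1 m with hd₀
  have hd₀0 : d₀ 0 = a := by simp [hd₀]
  have hd₀1 : d₀ 1 = m := by simp [hd₀]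
  have hd₀deg : d₀.degree = 2 * q := by
    rw [hd₀, map_add, Finsupp.degree_single, Finsupp.degree_single, hsum]
  have hsF : s.F = monomial d₀ 1 := rfl
  have hsr : s.r = d₀ := rfl
  -- `q ∤ pᵉ`, `q ∤ a` (since `p ∤ p - 1`), `q ∤ q + pᵉ`
  have hndvd_pe : ¬ q ∣ p ^ e := by
    intro h
    have h1 := Nat.le_of_dvd hpe h
    rw [hqe] at h1
    have h2 : p ^ e * p ≤ p ^ e * 1 := by rwa [mul_one]
    exact absurd (Nat.le_of_mul_le_mul_left h2 hpe) (by omega)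
  have hndvd_a : ¬ q ∣ a := by
    intro h
    rw [hqe, ha] at h
    have h' : p ∣ p - 1 := (Nat.mul_dvd_mul_iff_left hpe).mp h
    have := Nat.le_of_dvd (by omega) h'
    omega
  have hndvd_qpe : ¬ q ∣ q + p ^ e := fun h => hndvd_pe ((Nat.dvd_add_right (dvd_refl q)).mp h)
  -- (1) cleanness of `F`
  have hnotP : ¬ IsPthPowerExponent q d₀ := fun h =>
    hndvd_a (hd₀0 ▸ (isPthPowerExponent_iff q d₀).mp h 0)
  have hclean : deletePthPowers q s.F = s.F := by
    rw [hsF, deletePthPowers_monomial, if_neg hnotP]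
  -- (2) `yʳ ∣ F`
  have hsupp : s.F.support = {d₀} := by
    rw [hsF, support_monomial, if_neg one_ne_zero]
  have hr : ∀ d ∈ s.F.support, s.r ≤ d := by
    intro d hd
    rw [hsupp, Finset.mem_singleton] at hd
    rw [hd, hsr]
  -- (3) order and shade of `s`
  have hord : ordZero s.F = ((2 * q : ℕ) : ℕ∞) := by
    rw [hsF, ordZero_monomial_one, hd₀deg]
  have hshade : s.shade = 0 := by
    show ordZero s.F - (s.r.degree : ℕ∞) = 0
    rw [hord, hsr, hd₀deg]
    exact tsub_self _
  -- (4) the translated chart transform, explicitly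
  have hχ : chartExponent q 0 d₀ = Finsupp.single 0 q + Finsupp.single 1 m := by
    ext i
    rw [chartExponent_apply]
    fin_cases i
    · simp [hd₀deg]; omega
    · simp [hd₀1]
  set G : MvPolynomial (Fin 2) K :=
    monomial (Finsupp.single 0 q + Finsupp.single 1 (q + p ^ e)) 1 +
      monomial (Finsupp.single 0 q + Finsupp.single 1 q) 1 +
      monomial (Finsupp.single 0 q + Finsupp.single 1 (p ^ e)) 1 +
      monomial (Finsupp.single 0 q) 1 with hG
  have hpt : pointTransform q 0 b s = G := by
    show translate b (chartTransform q 0 s.F) = G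
    rw [hsF, chartTransform_monomial_one, hχ, monomial_single_add, ← X_pow_eq_monomial]
    unfold translate
    simp only [map_mul, map_pow, aeval_X, hb0, hb1, map_zero, add_zero, map_one]
    rw [hm, add_one_pow_prime_pow_mul_succ p (X 1 : MvPolynomial (Fin 2) K) e, ← hq, hG]
    simp only [mul_add, mul_one, X_pow_eq_monomial, monomial_mul]
  -- (5) the cleaning deletes exactly the two `q`-th powers
  have hP2 : IsPthPowerExponent q (Finsupp.single (0 : Fin 2) q + Finsupp.single 1 q) := by
    rw [isPthPowerExponent_iff]; intro i; fin_cases i <;> simp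
  have hP4 : IsPthPowerExponent q (Finsupp.single (0 : Fin 2) q) := by
    rw [isPthPowerExponent_iff]; intro i; fin_cases i <;> simp
  have hP1 : ¬ IsPthPowerExponent q (Finsupp.single (0 : Fin 2) q + Finsupp.single 1 (q + p ^ e)) := by
    intro h; apply hndvd_qpe; simpa using (isPthPowerExponent_iff q _).mp h 1
  have hP3 : ¬ IsPthPowerExponent q (Finsupp.single (0 : Fin 2) q + Finsupp.single 1 (p ^ e)) := by
    intro h; apply hndvd_pe; simpa using (isPthPowerExponent_iff q _).mp h 1
  have hF1 : (step q 0 b s).F =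
      monomial (Finsupp.single 0 q + Finsupp.single 1 (q + p ^ e)) 1 +
        monomial (Finsupp.single 0 q + Finsupp.single 1 (p ^ e)) 1 := by
    show deletePthPowers q (pointTransform q 0 b s) = _
    rw [hpt, hG, deletePthPowers_add, deletePthPowers_add, deletePthPowers_add,
      deletePthPowers_monomial, deletePthPowers_monomial, deletePthPowers_monomial,
      deletePthPowers_monomial, if_neg hP1, if_pos hP2, if_neg hP3, if_pos hP4, add_zero, add_zero]
  -- (6) the new multiplicities
  have hr1 : (step q 0 b s).r = Finsupp.single 0 q := by
    show newMult q 0 b s = _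
    rw [newMult_eq q 0 b hb0 s hord, hsr]
    ext i
    fin_cases i
    · simp [hb0]; omega
    · simp [hb1]
  -- (7) the new order and shade
  have hne : (Finsupp.single (0 : Fin 2) q + Finsupp.single 1 (q + p ^ e)) ≠
      Finsupp.single 0 q + Finsupp.single 1 (p ^ e) := by
    intro h
    have := DFunLike.congr_fun h 1
    simp at this
    omega
  have hdeg2 : (Finsupp.single (0 : Fin 2) q + Finsupp.single 1 (p ^ e)).degree = q + p ^ e := by
    rw [map_add, Finsupp.degree_single, Finsupp.degree_single]
  have hdeg1 : (Finsupp.single (0 : Fin 2) q + Finsupp.single 1 (q + p ^ e)).degree =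
      q + (q + p ^ e) := by
    rw [map_add, Finsupp.degree_single, Finsupp.degree_single]
  have hord1 : ordZero (step q 0 b s).F = ((q + p ^ e : ℕ) : ℕ∞) := by
    rw [hF1, ordZero_binomial hne (by rw [hdeg1, hdeg2]; omega), hdeg2]
  have hshade1 : (step q 0 b s).shade = ((p ^ e : ℕ) : ℕ∞) := by
    show ordZero (step q 0 b s).F - ((step q 0 b s).r.degree : ℕ∞) = _
    rw [hord1, hr1, Finsupp.degree_single, ← ENat.coe_sub]
    norm_cast
    omega
  -- (8) the point is equiconstant: every monomial of `G` has degree `≥ q`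
  have hequi : IsEquimultiplePoint q 0 b s := by
    intro d _ hdlt
    rw [hpt, hG]
    simp only [coeff_add, coeff_monomial]
    have h1 : ¬ Finsupp.single (0 : Fin 2) q + Finsupp.single 1 (q + p ^ e) = d := by
      rintro rfl; rw [hdeg1] at hdlt; omega
    have h2 : ¬ Finsupp.single (0 : Fin 2) q + Finsupp.single 1 q = d := by
      rintro rfl; rw [map_add, Finsupp.degree_single, Finsupp.degree_single] at hdlt; omega
    have h3 : ¬ Finsupp.single (0 : Fin 2) q + Finsupp.single 1 (p ^ e) = d := by
      rintro rfl; rw [hdeg2] at hdlt; omega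
    have h4 : ¬ Finsupp.single (0 : Fin 2) q = d := by
      rintro rfl; rw [Finsupp.degree_single] at hdlt; omega
    rw [if_neg h1, if_neg h2, if_neg h3, if_neg h4]
    ring
  have hinc : ShadeIncreases q 0 b s := by
    unfold ShadeIncreases
    rw [hshade, hshade1]
    exact_mod_cast hpe
  exact ⟨hclean, hr, hord, hshade, hequi, hF1, hr1, hshade1, hinc, ⟨hb0, hequi, hinc⟩⟩

/-- **Moh's bound is attained for every prime `p` and every exponent `e + 1`, already for
surfaces**: with `F = y₀^{pᵉ(p−1)} y₁^{pᵉ(p+1)}`, `r = (pᵉ(p−1), pᵉ(p+1))` (shade `0`), the point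
`y₁ = 1` of the `y₀`-chart of the blow-up of the origin is a kangaroo point at which the shade
becomes exactly `pᵉ = 0 + p^{(e+1)−1}`; all hypotheses of `PointBlowup.mohBound` hold (cleaned,
`yʳ ∣ F`, order `2p^{e+1} ≥ p^{e+1}`). [folklore] -/
theorem mohBound_attained (e : ℕ) :
    let q : ℕ := p ^ (e + 1)
    let d₀ : Fin 2 →₀ ℕ := Finsupp.single 0 (p ^ e * (p - 1)) + Finsupp.single 1 (p ^ e * (p + 1))
    let s : State (Fin 2) K := ⟨monomial d₀ 1, d₀⟩
    let b : Fin 2 → K := fun i => if i = 1 then 1 else 0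
    b 0 = 0 ∧ deletePthPowers q s.F = s.F ∧ (∀ d ∈ s.F.support, s.r ≤ d) ∧
      ((q : ℕ) : ℕ∞) ≤ ordZero s.F ∧ s.shade = 0 ∧ IsKangarooPoint q 0 b s ∧
      (step q 0 b s).shade = s.shade + ((p ^ (e + 1 - 1) : ℕ) : ℕ∞) ∧
      (step q 0 b s).shade = ((p ^ e : ℕ) : ℕ∞) := by
  intro q d₀ s b
  have hb0 : b 0 = 0 := by simp [b]
  have hb1 : b 1 = 1 := by simp [b]
  obtain ⟨hclean, hr, hord, hshade, -, -, -, hshade1, -, hk⟩ :=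
    mohBound_attained_of_eq p K e (q := q) rfl rfl rfl b hb0 hb1
  refine ⟨hb0, hclean, hr, ?_, hshade, hk, ?_, hshade1⟩
  · rw [hord]; exact_mod_cast Nat.le_mul_of_pos_left q two_pos
  · rw [hshade1, hshade, zero_add, Nat.add_sub_cancel]

/-- In particular an antelope point exists at order `p^{e+1}` for every `p` and `e`: the increase
of the residual order under a point blow-up is a phenomenon of every characteristic and every
purely inseparable exponent, already for surfaces and already from residual order `0`. [folklore] -/
theorem exists_isAntelopePoint (e : ℕ) :
    ∃ s : State (Fin 2) K, s.shade = 0 ∧ deletePthPowers (p ^ (e + 1)) s.F = s.F ∧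
      IsAntelopePoint (p ^ (e + 1)) s ∧
      ∃ (j : Fin 2) (b : Fin 2 → K), (step (p ^ (e + 1)) j b s).shade = ((p ^ e : ℕ) : ℕ∞) := by
  obtain ⟨-, hclean, -, -, hshade, hk, -, hshade1⟩ := mohBound_attained p K e
  exact ⟨_, hshade, hclean, ⟨0, _, hk⟩, 0, _, hshade1⟩

end Attained

end PointBlowup

end Literature.AlgebraicGeometry.Resolution

end
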